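import Summits.Ventures.DiscreteObjects.Hadamard.Order2pNegaParity
import Summits.Ventures.DiscreteObjects.Hadamard.CyclotomicClassParity

/-!
# H(668): the mod-167 code parities in one statement (kernel; packaging of gen 15)

Framing: lottery ticket; floor = certified bounds/negative ranges.

Cell pub-namedobj (venture DiscreteObjects), target (H), hadamard gen 15.  One quotable kernel statement for STATEMENT.md,
`hadamard668_code_parity_summary`: for every Hadamard matrix `H` of order `668` and every signed automorphism `(π, κ, d, e)`
(`H (π i) (κ j) = d i · e j · H i j`):
1. (PLAIN CYCLES) if `π^M = κ^M = 1` pointwise with `167 ∤ M`, the number of `π`-cycles with sign product `+1` is even and the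
   number of `κ`-cycles with sign product `+1` is even (`Σ_L #{points on such cycles of length L}/L` is even);
2. (ORDER 14) if `π¹⁴ = κ¹⁴ = 1` and `π⁷`, `κ⁷` are fixed-point-free: `28 ∣ #{i : π² i ≠ i}` and `28 ∣ #{j : κ² j ≠ j}`;
3. (ORDER 22) if `π²² = κ²² = 1` and `π¹¹`, `κ¹¹` are fixed-point-free: `44 ∣ #{i : π² i ≠ i}` and `44 ∣ #{j : κ² j ≠ j}`;
4. (ORDER DIVIDING 4) if `κ⁴ = 1` pointwise: (number of nega `2`-cycles of `κ`) + (number of plain `4`-cycles of `κ`) is EVEN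
   (instance `m = 4` of the cyclotomic class theorem, `167 ≡ 3 (mod 4)`; with `g⁴ = ±1` on signs: if some row or column is
   not on a `4`-cycle then all `4`-cycles are plain, so '#nega 2-cycles + #4-cycles is even').
All four are instances of the even-multiplicity theorem for the self-dual `𝔽₁₆₇`-code of `H` (`HadamardSignedAutParity`,
`PlainCyclesEven`, `Order2pNegaParity`, `CyclotomicClassParity`).  PARITY / STRUCTURE statements: no order is excluded.
Ours; no `sorry`.
-/

open Polynomial Finset BigOperators Matrix

namespace Summit.Ventures.DiscreteObjects.Hadamard

open Literature.Combinatorics.Designs.GoethalsSeidel (IsHadamardMatrix)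

variable {ι : Type*} [Fintype ι] [DecidableEq ι]

/-- **H(668), automorphisms with `κ⁴ = 1`: the number of plain `4`-cycles plus the number of nega `2`-cycles of `κ` is EVEN**
(`Φ₄`-instance of the cyclotomic class theorem: `167 ≡ 3 (mod 4)`; a `4`-cycle is plain when `e j·e(κ j)·e(κ² j)·e(κ³ j) = 1`,
a `2`-cycle `(j, κ j)` is nega when `e j·e(κ j) = −1`; the counts are `#points/4` and `#points/2`). -/
theorem hadamard668_aut_pow_four_code_parity {H : Matrix ι ι ℤ} (hH : IsHadamardMatrix H)
    (hι : Fintype.card ι = 668) {π κ : Equiv.Perm ι} {d e : ι → ℤ} (haut : IsSignedAut H π κ d e)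
    (hκ : ∀ j, (κ ^ 4) j = j) :
    2 ∣ (univ.filter (fun j => (κ ^ 2) j = j ∧ κ j ≠ j ∧ e j * e (κ j) = -1)).card / 2 +
      (univ.filter (fun j => (κ ^ 2) j ≠ j ∧ e j * e (κ j) * e ((κ ^ 2) j) * e ((κ ^ 3) j) = 1)).card / 4 := by
  have h := hadamard668_signedAut_cyclotomic_cycles_even hH hι haut (M := 4) (by norm_num) hκ (by norm_num)
    (m := 4) (j₀ := 1) (by norm_num) ⟨2, by norm_num⟩ (by norm_num)
  -- periods under κ⁴ = 1
  have hP4 : ∀ j, Function.IsPeriodicPt κ 4 j := fun j => by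
    rw [Function.IsPeriodicPt, Function.IsFixedPt, Equiv.Perm.iterate_eq_pow]
    exact hκ j
  have hfix : ∀ j, (κ ^ Function.minimalPeriod κ j) j = j := fun j => by
    have := Function.iterate_minimalPeriod (f := κ) (x := j)
    rwa [Equiv.Perm.iterate_eq_pow] at this
  have hdvd4 : ∀ j, Function.minimalPeriod κ j ∣ 4 := fun j => (hP4 j).minimalPeriod_dvd
  have hcases : ∀ j, Function.minimalPeriod κ j = 1 ∨ Function.minimalPeriod κ j = 2 ∨ Function.minimalPeriod κ j = 4 := by
    intro j
    have hd := hdvd4 j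
    have hpos : 0 < Function.minimalPeriod κ j := (hP4 j).minimalPeriod_pos (by norm_num)
    have hle : Function.minimalPeriod κ j ≤ 4 := Nat.le_of_dvd (by norm_num) hd
    interval_cases (Function.minimalPeriod κ j) <;> simp_all
  have hper2 : ∀ j, Function.minimalPeriod κ j = 2 ↔ (κ ^ 2) j = j ∧ κ j ≠ j := by
    intro j
    constructor
    · intro h2
      refine ⟨by rw [← h2]; exact hfix j, fun h1 => ?_⟩
      have := Function.minimalPeriod_eq_one_iff_isFixedPt.mpr h1
      omega
    · rintro ⟨h2, h1⟩
      rcases hcases j with hc | hc | hc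
      · exact absurd (Function.minimalPeriod_eq_one_iff_isFixedPt.mp hc) h1
      · exact hc
      · exfalso
        have hp : Function.IsPeriodicPt κ 2 j := by
          rw [Function.IsPeriodicPt, Function.IsFixedPt, Equiv.Perm.iterate_eq_pow]; exact h2
        have := hp.minimalPeriod_le (by norm_num)
        omega
  have hper4 : ∀ j, Function.minimalPeriod κ j = 4 ↔ (κ ^ 2) j ≠ j := by
    intro j
    constructor
    · intro h4 h2
      have hp : Function.IsPeriodicPt κ 2 j := by
        rw [Function.IsPeriodicPt, Function.IsFixedPt, Equiv.Perm.iterate_eq_pow]; exact h2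
      have := hp.minimalPeriod_le (by norm_num)
      omega
    · intro h2
      rcases hcases j with hc | hc | hc
      · exfalso
        apply h2
        have h1 := Function.minimalPeriod_eq_one_iff_isFixedPt.mp hc
        rw [pow_two, Equiv.Perm.mul_apply, h1, h1]
      · exfalso
        apply h2
        rw [← hc]
        exact hfix j
      · exact hc
  -- evaluate the five-term sum
  rw [Finset.sum_range_succ, Finset.sum_range_succ, Finset.sum_range_succ, Finset.sum_range_succ,
    Finset.sum_range_succ, Finset.sum_range_zero, zero_add, Nat.div_zero, zero_add] at h
  have h1 : (univ.filter (fun j => Function.minimalPeriod κ j = 1 ∧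
      ((∏ i ∈ range 1, e ((κ ^ i) j) = 1 ∧ 4 ∣ 1) ∨
       (∏ i ∈ range 1, e ((κ ^ i) j) = -1 ∧ 4 ∣ 2 * 1 ∧ ¬ 4 ∣ 1)))) = ∅ := by
    rw [Finset.eq_empty_iff_forall_notMem]
    intro j hj
    rw [mem_filter] at hj
    rcases hj.2.2 with ⟨-, h4⟩ | ⟨-, h4, -⟩ <;> omega
  have h3 : (univ.filter (fun j => Function.minimalPeriod κ j = 3 ∧
      ((∏ i ∈ range 3, e ((κ ^ i) j) = 1 ∧ 4 ∣ 3) ∨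
       (∏ i ∈ range 3, e ((κ ^ i) j) = -1 ∧ 4 ∣ 2 * 3 ∧ ¬ 4 ∣ 3)))) = ∅ := by
    rw [Finset.eq_empty_iff_forall_notMem]
    intro j hj
    rw [mem_filter] at hj
    rcases hj.2.2 with ⟨-, h4⟩ | ⟨-, h4, -⟩ <;> omega
  have h2 : (univ.filter (fun j => Function.minimalPeriod κ j = 2 ∧
      ((∏ i ∈ range 2, e ((κ ^ i) j) = 1 ∧ 4 ∣ 2) ∨
       (∏ i ∈ range 2, e ((κ ^ i) j) = -1 ∧ 4 ∣ 2 * 2 ∧ ¬ 4 ∣ 2)))) =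
      univ.filter (fun j => (κ ^ 2) j = j ∧ κ j ≠ j ∧ e j * e (κ j) = -1) := by
    apply Finset.filter_congr
    intro j _
    rw [hper2 j, Finset.prod_range_succ, Finset.prod_range_succ, Finset.prod_range_zero, one_mul, pow_zero, pow_one,
      Equiv.Perm.one_apply]
    constructor
    · rintro ⟨⟨hf, hne⟩, (⟨-, h4⟩ | ⟨hs, -, -⟩)⟩
      · omega
      · exact ⟨hf, hne, hs⟩
    · rintro ⟨hf, hne, hs⟩
      exact ⟨⟨hf, hne⟩, Or.inr ⟨hs, dvd_refl 4, by omega⟩⟩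
  have h4 : (univ.filter (fun j => Function.minimalPeriod κ j = 4 ∧
      ((∏ i ∈ range 4, e ((κ ^ i) j) = 1 ∧ 4 ∣ 4) ∨
       (∏ i ∈ range 4, e ((κ ^ i) j) = -1 ∧ 4 ∣ 2 * 4 ∧ ¬ 4 ∣ 4)))) =
      univ.filter (fun j => (κ ^ 2) j ≠ j ∧ e j * e (κ j) * e ((κ ^ 2) j) * e ((κ ^ 3) j) = 1) := by
    apply Finset.filter_congr
    intro j _
    rw [hper4 j, Finset.prod_range_succ, Finset.prod_range_succ, Finset.prod_range_succ, Finset.prod_range_succ,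
      Finset.prod_range_zero, one_mul, pow_zero, pow_one, Equiv.Perm.one_apply]
    constructor
    · rintro ⟨hne, (⟨hs, -⟩ | ⟨-, -, h4⟩)⟩
      · exact ⟨hne, hs⟩
      · exact absurd (dvd_refl 4) h4
    · rintro ⟨hne, hs⟩
      exact ⟨hne, Or.inl ⟨hs, dvd_refl 4⟩⟩
  rw [h1, h2, h3, h4, Finset.card_empty, Nat.zero_div, zero_add, add_zero] at h
  exact h

/-- **H(668): THE MOD-167 CODE PARITIES** (one statement; see the module docstring for the reading of 1–4). -/
theorem hadamard668_code_parity_summary {H : Matrix ι ι ℤ} (hH : IsHadamardMatrix H) (hι : Fintype.card ι = 668)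
    {π κ : Equiv.Perm ι} {d e : ι → ℤ} (haut : IsSignedAut H π κ d e) :
    (∀ M : ℕ, 0 < M → (∀ i, (π ^ M) i = i) → (∀ j, (κ ^ M) j = j) → ¬ 167 ∣ M →
      (2 ∣ ∑ L ∈ range (M + 1),
        (univ.filter (fun i => Function.minimalPeriod π i = L ∧ ∏ t ∈ range L, d ((π ^ t) i) = 1)).card / L) ∧
      (2 ∣ ∑ L ∈ range (M + 1),
        (univ.filter (fun j => Function.minimalPeriod κ j = L ∧ ∏ t ∈ range L, e ((κ ^ t) j) = 1)).card / L)) ∧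
    ((∀ i, (π ^ 14) i = i) → (∀ j, (κ ^ 14) j = j) → (∀ i, (π ^ 7) i ≠ i) → (∀ j, (κ ^ 7) j ≠ j) →
      28 ∣ (univ.filter (fun i => (π ^ 2) i ≠ i)).card ∧ 28 ∣ (univ.filter (fun j => (κ ^ 2) j ≠ j)).card) ∧
    ((∀ i, (π ^ 22) i = i) → (∀ j, (κ ^ 22) j = j) → (∀ i, (π ^ 11) i ≠ i) → (∀ j, (κ ^ 11) j ≠ j) →
      44 ∣ (univ.filter (fun i => (π ^ 2) i ≠ i)).card ∧ 44 ∣ (univ.filter (fun j => (κ ^ 2) j ≠ j)).card) ∧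
    ((∀ j, (κ ^ 4) j = j) →
      2 ∣ (univ.filter (fun j => (κ ^ 2) j = j ∧ κ j ≠ j ∧ e j * e (κ j) = -1)).card / 2 +
        (univ.filter (fun j => (κ ^ 2) j ≠ j ∧ e j * e (κ j) * e ((κ ^ 2) j) * e ((κ ^ 3) j) = 1)).card / 4) :=
  ⟨fun _ hM hπM hκM h167 => hadamard668_signedAut_plain_cycles_even hH hι haut hM hπM hκM h167,
    fun hπ hκ hπf hκf => hadamard668_aut_order14_fpf hH hι haut hπ hκ hπf hκf,
    fun hπ hκ hπf hκf => hadamard668_aut_order22_fpf hH hι haut hπ hκ hπf hκf,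
    fun hκ => hadamard668_aut_pow_four_code_parity hH hι haut hκ⟩

end Summit.Ventures.DiscreteObjects.Hadamard
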